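import Summits.Ventures.WeilGRH.KeyWindowSmoothing
import HarnessLib

/-!
# GRH arm (rh-explicit, venture WeilGRH): from SECTION language back to TEST-FUNCTION language — a strict upper
  bound for the Markov key form at a window function is attained by a genuine test function on any larger window

Cell `rh-explicit`, WEIL TRACK — GRH ARM (lit/typing seat weil-grh-5; closes the bridge plan GRH-LIT-AS-PRINTED A27:
reading (b) of weil-grh-4's «un-truncated corollaries» 17(a)/17(c), labelled 'analytic corollary, untyped' until now).
Sequel of `KeyWindowSmoothing.lean` (mollified window functions: test functions, convergence of the shift pairings,
Jensen contraction of the increments) and `KeyMarkovForm.lean` (the dictionary `keyMarkovForm = E_{a,L,v,N}` on test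
functions).

* `keyMarkovForm_eq_reduced_of_isWeilTest / _of_isWindowFunction` — the REDUCED form: for test and window functions
  `keyMarkovForm a L v c w = ∫₀^∞ ρ_a D_s(w) ds − C_{a,L}‖w‖₂² − Σ_{log n<2c} (Λ(n)/√n)·2Re(v(n)(w⋆w̃)(log n))`
  (`C_{a,L} = 2∫killing_a + log 4π + γ − L`; the `|v(n)|²` terms cancel);
* `keyMarkovForm_window_eq_of_isWindowFunction` — for a window function on `[-b, b]` the form does not depend on the
  form's window parameter `c ≥ b` (the extra prime lengths see a vanishing autocorrelation);
* `eventually_keyMarkovForm_mollify_le` — along bumps `φ_i` (`rOut → 0`, `rOut ≤ 2 rIn`, `rOut ≤ 1`):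
  eventually `keyMarkovForm a L v c (φ_i ⋆ u) ≤ keyMarkovForm a L v c u + δ` and `|‖φ_i⋆u‖₂² − ‖u‖₂²| < δ`
  (finite part by convergence of the pairings, archimedean part by Jensen: it never exceeds that of `u`);
* ★ `exists_isWeilTest_keyMarkovForm_lt` — **THE TRANSFER**: `u` a window function on `[-b, b]`, `0 ≤ b < t`,
  `keyMarkovForm a L v t u < B‖u‖₂²` ⇒ there is a TEST function `g` with `tsupport g ⊆ [-t, t]` and
  `keyMarkovForm a L v t g < B‖g‖₂²`;
* consequences in the language of the summit-side predicates: `not_weilPositivityOnKey_of_isWindowFunction`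
  (a negative section value below `log(N+1)/2` refutes `WeilPositivityOnKey a L v N`),
  `keyMargin_le_of_isWindowFunction` (every margin of `E_{a,L,v,N}` over test functions is `≤` any certified
  Rayleigh bound of a section vector on a smaller window — G33's corollary «the same bound holds for the infimum over ALL
  parity-a test functions», now for every window `t > b`), `not_weilPositivityOnChar_of_isWindowFunction` (a trigonometric
  window with negative twisted window form on `[-b, b]` refutes `WeilPositivityOnChar χ t` for every `t > b`, `q ≠ 1`).

Everything is proved; no definitions; no named facts; RH/GRH-free.  Sources: mollification [folklore]; the form through
increments: Bombieri 2000 Thm 2 p. 193 [Bombieri2000Weil]; Weil 1952 (11) pp. 261–262 [Weil1952FormulesExplicites].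
-/

set_option autoImplicit false

noncomputable section

open Complex Filter Set MeasureTheory ContinuousLinearMap Metric
open scoped Real Topology ComplexConjugate Convolution ArithmeticFunction.vonMangoldt

namespace Summit.Ventures.WeilGRH

open Literature.NumberTheory.LFunctions
open Summit.RiemannHypothesis.RiemannHypothesis.Theorems.WeilFormatC

variable {b : ℝ} {u g : ℝ → ℂ} {q : ℕ}

/-! ## The reduced form of the Markov key form -/

/-- The reduced form from the twisted-increment identity (shared by test and window functions). [folklore] -/
private theorem keyMarkovForm_eq_reduced_of_twist (w : ℝ → ℂ)
    (hD : ∀ (ω : ℂ) (t : ℝ), weilTwistIncrement (conj ω) w t =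
      (1 + ‖ω‖ ^ 2) * (∫ x : ℝ, ‖w x‖ ^ 2) - 2 * (ω * weilConv w (weilReflect w) t).re)
    (a : ℕ) (L : ℝ) (v : ℕ → ℂ) (c : ℝ) :
    keyMarkovForm a L v c w =
      (∫ t in Ioi (0 : ℝ), weilArchDensityPar a t * weilIncrement w t) -
        (2 * (∫ t in Ioi (0 : ℝ), weilKillingDensityPar a t) +
          (Real.log (4 * π) + Real.eulerMascheroniConstant - L)) * (∫ x : ℝ, ‖w x‖ ^ 2) -
        ∑ n ∈ weilPrimeIndex c, (Λ n : ℝ) / Real.sqrt n *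
          (2 * (v n * weilConv w (weilReflect w) (Real.log n)).re) := by
  set Nrm : ℝ := ∫ x : ℝ, ‖w x‖ ^ 2 with hNrm
  have hS : ∑ n ∈ weilPrimeIndex c, (Λ n : ℝ) / Real.sqrt n * weilTwistIncrement (conj (v n)) w (Real.log n) =
      (∑ n ∈ weilPrimeIndex c, (Λ n : ℝ) / Real.sqrt n * (1 + ‖v n‖ ^ 2)) * Nrm -
        ∑ n ∈ weilPrimeIndex c, (Λ n : ℝ) / Real.sqrt n *
          (2 * (v n * weilConv w (weilReflect w) (Real.log n)).re) := by
    rw [Finset.sum_mul, ← Finset.sum_sub_distrib]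
    refine Finset.sum_congr rfl fun n _ ↦ ?_
    rw [hD (v n) (Real.log n)]
    ring
  unfold keyMarkovForm keyDirichletEnergy keyMarkovConstant
  rw [hS]
  ring

/-- **Reduced form on test functions**:
`keyMarkovForm a L v c g = ∫₀^∞ ρ_a D_s(g) − C_{a,L}‖g‖₂² − Σ_{log n<2c}(Λ(n)/√n)·2Re(v(n)(g⋆g̃)(log n))`.
[cite: Bombieri2000Weil, Thm 2 (p. 193)] -/
theorem keyMarkovForm_eq_reduced_of_isWeilTest (hg : IsWeilTest g) (a : ℕ) (L : ℝ) (v : ℕ → ℂ) (c : ℝ) :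
    keyMarkovForm a L v c g =
      (∫ t in Ioi (0 : ℝ), weilArchDensityPar a t * weilIncrement g t) -
        (2 * (∫ t in Ioi (0 : ℝ), weilKillingDensityPar a t) +
          (Real.log (4 * π) + Real.eulerMascheroniConstant - L)) * (∫ x : ℝ, ‖g x‖ ^ 2) -
        ∑ n ∈ weilPrimeIndex c, (Λ n : ℝ) / Real.sqrt n *
          (2 * (v n * weilConv g (weilReflect g) (Real.log n)).re) :=
  keyMarkovForm_eq_reduced_of_twist g (weilTwistIncrement_conj_of_isWeilTest hg) a L v c

/-- **Reduced form on window functions**. [cite: Bombieri2000Weil, Thm 2 (p. 193)] -/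
theorem keyMarkovForm_eq_reduced_of_isWindowFunction (hu : IsWindowFunction b u) (a : ℕ) (L : ℝ)
    (v : ℕ → ℂ) (c : ℝ) :
    keyMarkovForm a L v c u =
      (∫ t in Ioi (0 : ℝ), weilArchDensityPar a t * weilIncrement u t) -
        (2 * (∫ t in Ioi (0 : ℝ), weilKillingDensityPar a t) +
          (Real.log (4 * π) + Real.eulerMascheroniConstant - L)) * (∫ x : ℝ, ‖u x‖ ^ 2) -
        ∑ n ∈ weilPrimeIndex c, (Λ n : ℝ) / Real.sqrt n *
          (2 * (v n * weilConv u (weilReflect u) (Real.log n)).re) :=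
  keyMarkovForm_eq_reduced_of_twist u (weilTwistIncrement_conj_of_isWindowFunction hu) a L v c

/-- **The form of a window function does not depend on the window parameter beyond its support**: for `u` on
`[-b, b]` and `b ≤ c`, `keyMarkovForm a L v c u = keyMarkovForm a L v b u` (the lengths `2b ≤ log n < 2c` see
`(u⋆ũ)(log n) = 0`). [folklore] -/
theorem keyMarkovForm_window_eq_of_isWindowFunction (hu : IsWindowFunction b u) {c : ℝ} (hbc : b ≤ c) (a : ℕ)
    (L : ℝ) (v : ℕ → ℂ) : keyMarkovForm a L v c u = keyMarkovForm a L v b u := by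
  have hmono : weilPrimeIndex b ⊆ weilPrimeIndex c := fun n hn ↦
    mem_weilPrimeIndex.2 ((mem_weilPrimeIndex.1 hn).trans_le (by linarith))
  rw [keyMarkovForm_eq_reduced_of_isWindowFunction hu a L v c, keyMarkovForm_eq_reduced_of_isWindowFunction hu a L v b,
    ← Finset.sum_subset hmono]
  intro n _ hnb
  have hge : 2 * b ≤ Real.log n := by
    by_contra h
    push Not at h
    exact hnb (mem_weilPrimeIndex.2 h)
  rw [weilConv_weilReflect_eq_zero_of_isWindowFunction hu (hge.trans (le_abs_self _)), mul_zero, Complex.zero_re,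
    mul_zero, mul_zero]

/-! ## The archimedean energy of a window function and of its mollifications -/

/-- The parity-`a` archimedean energy of a window function converges absolutely (`b ≥ 0`). [folklore] -/
theorem integrableOn_arch_of_isWindowFunction (hb : 0 ≤ b) (hu : IsWindowFunction b u) (a : ℕ) :
    IntegrableOn (fun t ↦ weilArchDensityPar a t * weilIncrement u t) (Ioi 0) := by
  have h := (integrableOn_weilArchDensityPar_mul_weilIncrementSesq hb hu hu a).re
  refine h.congr (Eventually.of_forall fun t ↦ ?_)
  simp only [weilIncrementSesq_self, RCLike.re_to_complex, ← Complex.ofReal_mul, Complex.ofReal_re]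

/-- **The archimedean energy never increases under smoothing** (Jensen contraction integrated against `ρ_a ≥ 0`).
[folklore] -/
theorem arch_mollify_le (hb : 0 ≤ b) (hu : IsWindowFunction b u) (φ : ContDiffBump (0 : ℝ)) (a : ℕ) :
    (∫ t in Ioi (0 : ℝ), weilArchDensityPar a t * weilIncrement (φ.normed volume ⋆[lsmul ℝ ℝ, volume] u) t) ≤
      ∫ t in Ioi (0 : ℝ), weilArchDensityPar a t * weilIncrement u t := by
  refine integral_mono_of_nonneg ?_ (integrableOn_arch_of_isWindowFunction hb hu a) ?_
  · refine (ae_restrict_iff' measurableSet_Ioi).2 (Eventually.of_forall fun t ht ↦ ?_)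
    exact mul_nonneg (weilArchDensityPar_nonneg_le a ht).1 (weilIncrement_nonneg _ _)
  · refine (ae_restrict_iff' measurableSet_Ioi).2 (Eventually.of_forall fun t ht ↦ ?_)
    exact mul_le_mul_of_nonneg_left (weilIncrement_mollify_le φ hu t) (weilArchDensityPar_nonneg_le a ht).1

/-! ## Upper semicontinuity of the form along mollifiers -/

/-- **Along mollifiers the form is eventually at most its value at the window function plus `δ`, and the norm is
`δ`-close**: bumps with `rOut → 0`, `rOut ≤ 2 rIn`, `rOut ≤ 1`; any form window `c`. [folklore] -/
theorem eventually_keyMarkovForm_mollify_le {φ : ℕ → ContDiffBump (0 : ℝ)} (hb : 0 ≤ b) (hu : IsWindowFunction b u)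
    (hφ : Tendsto (fun i ↦ (φ i).rOut) atTop (𝓝 0)) (h'φ : ∀ᶠ i in atTop, (φ i).rOut ≤ 2 * (φ i).rIn)
    (h1 : ∀ i, (φ i).rOut ≤ 1) (a : ℕ) (L : ℝ) (v : ℕ → ℂ) (c : ℝ) {δ : ℝ} (hδ : 0 < δ) :
    ∀ᶠ i in atTop,
      keyMarkovForm a L v c ((φ i).normed volume ⋆[lsmul ℝ ℝ, volume] u) ≤ keyMarkovForm a L v c u + δ ∧
        |(∫ x, ‖((φ i).normed volume ⋆[lsmul ℝ ℝ, volume] u) x‖ ^ 2) - ∫ x, ‖u x‖ ^ 2| < δ := by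
  set gi : ℕ → ℝ → ℂ := fun i ↦ (φ i).normed volume ⋆[lsmul ℝ ℝ, volume] u with hgi
  set C : ℝ := 2 * (∫ t in Ioi (0 : ℝ), weilKillingDensityPar a t) +
    (Real.log (4 * π) + Real.eulerMascheroniConstant - L) with hC
  -- the finite part as a function of the norm and the pairings
  set T : ℕ → ℝ := fun i ↦ -(C * ∫ x, ‖gi i x‖ ^ 2) -
    ∑ n ∈ weilPrimeIndex c, (Λ n : ℝ) / Real.sqrt n *
      (2 * (v n * weilConv (gi i) (weilReflect (gi i)) (Real.log n)).re) with hT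
  set Tu : ℝ := -(C * ∫ x, ‖u x‖ ^ 2) -
    ∑ n ∈ weilPrimeIndex c, (Λ n : ℝ) / Real.sqrt n *
      (2 * (v n * weilConv u (weilReflect u) (Real.log n)).re) with hTu
  have hN := tendsto_integral_norm_sq_mollify hu hφ h'φ h1
  have hk : ∀ n : ℕ, Tendsto (fun i ↦ weilConv (gi i) (weilReflect (gi i)) (Real.log n)) atTop
      (𝓝 (weilConv u (weilReflect u) (Real.log n))) := by
    intro n
    simp_rw [hgi, weilConv_weilReflect_eq_integral_shift_pair]
    exact tendsto_integral_shift_mul_conj_mollify hu hφ h'φ h1 (Real.log n)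
  have hTt : Tendsto T atTop (𝓝 Tu) := by
    refine (hN.const_mul C).neg.sub (tendsto_finsetSum _ fun n _ ↦ ?_)
    refine Tendsto.const_mul _ (Tendsto.const_mul 2 ?_)
    exact (Complex.continuous_re.tendsto _).comp (tendsto_const_nhds.mul (hk n))
  have hT_ev : ∀ᶠ i in atTop, T i < Tu + δ := (tendsto_order.1 hTt).2 _ (by linarith)
  have hN_ev : ∀ᶠ i in atTop, dist (∫ x, ‖gi i x‖ ^ 2) (∫ x, ‖u x‖ ^ 2) < δ := Metric.tendsto_nhds.1 hN δ hδ
  filter_upwards [hT_ev, hN_ev] with i hTi hNi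
  refine ⟨?_, by rwa [Real.dist_eq] at hNi⟩
  have hA := arch_mollify_le hb hu (φ i) a
  have e1 : keyMarkovForm a L v c (gi i) =
      (∫ t in Ioi (0 : ℝ), weilArchDensityPar a t * weilIncrement (gi i) t) + T i := by
    rw [keyMarkovForm_eq_reduced_of_isWeilTest (isWeilTest_mollify (φ i) hu) a L v c]
    ring
  have e2 : keyMarkovForm a L v c u = (∫ t in Ioi (0 : ℝ), weilArchDensityPar a t * weilIncrement u t) + Tu := by
    rw [keyMarkovForm_eq_reduced_of_isWindowFunction hu a L v c]
    ring
  rw [e1, e2]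
  linarith

/-! ## The transfer: a strict section bound is attained by a test function on any larger window -/

/-- **FROM A WINDOW FUNCTION TO A TEST FUNCTION.**  Let `u` be a window function on `[-b, b]`, `0 ≤ b < t`, with a
STRICT Rayleigh bound `keyMarkovForm a L v t u < B‖u‖₂²`.  Then some Weil test function `g` supported in `[-t, t]`
satisfies `keyMarkovForm a L v t g < B‖g‖₂²` (a mollification `φ ⋆ u` with a small bump). [folklore] -/
theorem exists_isWeilTest_keyMarkovForm_lt (hb : 0 ≤ b) (hu : IsWindowFunction b u) {t : ℝ} (hbt : b < t) (a : ℕ)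
    (L : ℝ) (v : ℕ → ℂ) {B : ℝ} (hB : keyMarkovForm a L v t u < B * ∫ x, ‖u x‖ ^ 2) :
    ∃ g : ℝ → ℂ, IsWeilTest g ∧ tsupport g ⊆ Icc (-t) t ∧ keyMarkovForm a L v t g < B * ∫ x, ‖g x‖ ^ 2 := by
  -- a bump sequence with radii r₀/(i+1), r₀ = min 1 (t − b)
  set r₀ : ℝ := min 1 (t - b) with hr₀
  have hr₀0 : 0 < r₀ := lt_min one_pos (by linarith)
  set r : ℕ → ℝ := fun i ↦ r₀ * (1 / ((i : ℝ) + 1)) with hr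
  have hrpos : ∀ i, 0 < r i := fun i ↦ by positivity
  have hrle : ∀ i, r i ≤ r₀ := fun i ↦ by
    rw [hr]
    have h1 : 1 / ((i : ℝ) + 1) ≤ 1 := by
      rw [div_le_one (by positivity)]
      linarith [Nat.cast_nonneg (α := ℝ) i]
    nlinarith
  let φ : ℕ → ContDiffBump (0 : ℝ) := fun i ↦ ⟨r i / 2, r i, half_pos (hrpos i), half_lt_self (hrpos i)⟩
  have hφ : Tendsto (fun i ↦ (φ i).rOut) atTop (𝓝 0) := by
    have h : Tendsto r atTop (𝓝 0) := by
      rw [hr]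
      simpa using (tendsto_one_div_add_atTop_nhds_zero_nat (𝕜 := ℝ)).const_mul r₀
    exact h
  have h'φ : ∀ᶠ i in atTop, (φ i).rOut ≤ 2 * (φ i).rIn := Eventually.of_forall fun i ↦ by
    show r i ≤ 2 * (r i / 2)
    linarith
  have h1 : ∀ i, (φ i).rOut ≤ 1 := fun i ↦ (hrle i).trans (min_le_left _ _)
  -- the margin and the tolerance
  set gap : ℝ := B * (∫ x, ‖u x‖ ^ 2) - keyMarkovForm a L v t u with hgap
  have hgap0 : 0 < gap := by rw [hgap]; linarith
  set δ : ℝ := gap / (2 * (1 + |B|)) with hδ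
  have hδ0 : 0 < δ := by rw [hδ]; positivity
  obtain ⟨i, hKi, hNi⟩ := (eventually_keyMarkovForm_mollify_le hb hu hφ h'φ h1 a L v t hδ0).exists
  refine ⟨(φ i).normed volume ⋆[lsmul ℝ ℝ, volume] u, isWeilTest_mollify (φ i) hu, ?_, ?_⟩
  · refine (tsupport_mollify_subset (φ i) hu).trans (Icc_subset_Icc ?_ ?_)
    · have : (φ i).rOut ≤ t - b := (hrle i).trans (min_le_right _ _)
      linarith
    · have : (φ i).rOut ≤ t - b := (hrle i).trans (min_le_right _ _)
      linarith
  · set Ni : ℝ := ∫ x, ‖((φ i).normed volume ⋆[lsmul ℝ ℝ, volume] u) x‖ ^ 2 with hNidef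
    set Nu : ℝ := ∫ x, ‖u x‖ ^ 2 with hNudef
    have hBN : B * Nu - B * Ni ≤ |B| * δ := by
      calc B * Nu - B * Ni = B * (Nu - Ni) := by ring
        _ ≤ |B * (Nu - Ni)| := le_abs_self _
        _ = |B| * |Ni - Nu| := by rw [abs_mul, abs_sub_comm]
        _ ≤ |B| * δ := mul_le_mul_of_nonneg_left hNi.le (abs_nonneg _)
    have hδid : δ * (2 * (1 + |B|)) = gap := by
      rw [hδ]
      field_simp
    nlinarith [abs_nonneg B]

/-! ## Consequences in the language of the summit-side predicates -/

/-- **A negative section value refutes window positivity of the key.**  `u` a window function on `[-b, b]`,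
`0 ≤ b < log(N+1)/2`, parity `a ≤ 1`: `keyMarkovForm a L v (log(N+1)/2) u < 0 ⇒ ¬ WeilPositivityOnKey a L v N`
(by `keyMarkovForm_window_eq_of_isWindowFunction` the hypothesis may be checked with the form window `b`). [folklore] -/
theorem not_weilPositivityOnKey_of_isWindowFunction (hb : 0 ≤ b) (hu : IsWindowFunction b u) {N : ℕ}
    (hbN : b < Real.log ((N : ℝ) + 1) / 2) {a : ℕ} (ha : a ≤ 1) (L : ℝ) (v : ℕ → ℂ)
    (hneg : keyMarkovForm a L v (Real.log ((N : ℝ) + 1) / 2) u < 0) : ¬ WeilPositivityOnKey a L v N := by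
  have hneg' : keyMarkovForm a L v (Real.log ((N : ℝ) + 1) / 2) u < 0 * ∫ x, ‖u x‖ ^ 2 := by rwa [zero_mul]
  obtain ⟨g, hg, hsupp, hlt⟩ := exists_isWeilTest_keyMarkovForm_lt hb hu hbN a L v hneg'
  rw [zero_mul] at hlt
  intro hpos
  have h := (weilPositivityOnKey_iff_keyMarkovForm_nonneg ha L v N).1 hpos g hg hsupp
  linarith

/-- **Margins are bounded by section Rayleigh quotients** (G33's corollary «the same bound holds for the infimum over
ALL parity-`a` test functions», for every window `t = log(N+1)/2 > b`): if `c‖h‖₂² ≤ E_{a,L,v,N}(h)` for every test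
`h` on `[-t, t]` and a window function `u ≠ 0` on `[-b, b]` has `keyMarkovForm a L v t u ≤ B‖u‖₂²`, then `c ≤ B`.
[folklore] -/
theorem keyMargin_le_of_isWindowFunction (hb : 0 ≤ b) (hu : IsWindowFunction b u) {N : ℕ}
    (hbN : b < Real.log ((N : ℝ) + 1) / 2) {a : ℕ} (ha : a ≤ 1) (L : ℝ) (v : ℕ → ℂ)
    (hu0 : 0 < ∫ x, ‖u x‖ ^ 2) {B : ℝ}
    (hB : keyMarkovForm a L v (Real.log ((N : ℝ) + 1) / 2) u ≤ B * ∫ x, ‖u x‖ ^ 2) {c : ℝ}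
    (hc : ∀ h : ℝ → ℂ, IsWeilTest h →
      tsupport h ⊆ Icc (-(Real.log ((N : ℝ) + 1) / 2)) (Real.log ((N : ℝ) + 1) / 2) →
      c * weilNorm2Sq h ≤ weilFinitePrimeQuadraticKey a L v N h) :
    c ≤ B := by
  by_contra hcB
  push Not at hcB
  have hlt : keyMarkovForm a L v (Real.log ((N : ℝ) + 1) / 2) u < c * ∫ x, ‖u x‖ ^ 2 :=
    hB.trans_lt (mul_lt_mul_of_pos_right hcB hu0)
  obtain ⟨g, hg, hsupp, hg_lt⟩ := exists_isWeilTest_keyMarkovForm_lt hb hu hbN a L v hlt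
  have hN : Real.exp (2 * (Real.log ((N : ℝ) + 1) / 2)) ≤ (N : ℝ) + 1 := by
    rw [mul_div_cancel₀ _ two_ne_zero, Real.exp_log (by positivity)]
  rw [keyMarkovForm_eq_weilFinitePrimeQuadraticKey hg hsupp hN ha L v] at hg_lt
  have h := hc g hg hsupp
  have hNrm : weilNorm2Sq g = ∫ x, ‖g x‖ ^ 2 := rfl
  rw [hNrm] at h
  linarith

/-- **A negative twisted window form refutes a rung for the character.**  `q ≠ 1`, `u` a window function on
`[-b, b]`, `0 ≤ b < t`: `𝓔^χ_b(u) − M^χ_b‖u‖₂² < 0 ⇒ ¬ WeilPositivityOnChar χ t` — the entry point for NEGATIVE section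
certificates of the arm (a trigonometric window with a certified negative twisted Gram value). [folklore] -/
theorem not_weilPositivityOnChar_of_isWindowFunction (hq : q ≠ 1) (χ : DirichletCharacter ℂ q) (hb : 0 ≤ b)
    (hu : IsWindowFunction b u) {t : ℝ} (hbt : b < t)
    (hneg : weilDirichletEnergyChar χ b u - weilMarkovConstantChar χ b * ∫ x, ‖u x‖ ^ 2 < 0) :
    ¬ WeilPositivityOnChar χ t := by
  have hkey : keyMarkovForm (charParity χ) (Real.log q) (fun n ↦ χ (n : ZMod q)) t u < 0 * ∫ x, ‖u x‖ ^ 2 := by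
    rw [zero_mul, keyMarkovForm_window_eq_of_isWindowFunction hu hbt.le]
    exact hneg
  obtain ⟨g, hg, hsupp, hlt⟩ := exists_isWeilTest_keyMarkovForm_lt hb hu hbt _ _ _ hkey
  rw [zero_mul, ← re_weilQuadraticChar_eq_keyMarkovForm hq χ hg hsupp] at hlt
  intro hpos
  have h := hpos g hg hsupp
  linarith

end Summit.Ventures.WeilGRH

end
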